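import Mathlib
import HarnessLib
import Summits.Schanuel.Schanuel.Theses.RealCoreRotationSplit

/-!
# Birth skeleton (BC3) for crux `RelOverRealCore` of route `RealCoreRotationSplit`

Crux item `stmt-Schanuel-19277`, decl
`Summit.Schanuel.Schanuel.Theses.RealCoreRotationSplit.RelOverRealCore`:
Schanuel RELATIVE TO THE REAL CORE — for every complex tuple `z` that is `ℚ`-free modulo
`E = span_ℚ Pc` (`P = ecl^ℝ(∅)`, `Pc` its image in `ℂ`), `trdeg` over `L = ℚ(Pc)` of `L(z, e^z)`
is at least the length of `z`.

## The line (route header, TWO-LAYER PLAN): split again, at the ROTATION SECTOR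

`E₂ := span_ℚ (Pc ∪ i·Pc)` (elements `a + i b`, `a, b ∈ P`), with the relative sector engine of the
route's `closes`, now run over the base `L = ℚ(Pc)` instead of `ℚ`:

* `stub_rotationOne` (the BC5 rung; n = 1 of the rotation count): for `b ∈ P ∖ 0` the rotation
  value `exp (i b)` is transcendental over `L = ℚ(Pc)`.  (At `k = 1` a tuple in `E₂` free mod `E`
  is `a + i b` with `b ≠ 0`; `a, i b` are algebraic over `L` and `e^a ∈ L`, so the relative count
  `≥ 1` is exactly this transcendence — proved below as `rotationCount_one`.)
* `stub_rotationCountGe2`: the relative count over `L` for tuples of length `≥ 2` inside `E₂`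
  that are `ℚ`-free modulo `E`.
* `stub_offCoreCount`: the relative count over `L₂ = L(E₂, exp E₂)` for tuples `ℚ`-free modulo
  `E₂`.

`relOverRealCore_of_counts : stub₁-statement → stub₂-statement → stub₃-statement → (body of
RelOverRealCore)` is PROVED outright, and the skeleton theorem
`RelOverRealCore_of : RelOverRealCore := relOverRealCore_of_counts stub_rotationOne
stub_rotationCountGe2 stub_offCoreCount` concludes the crux BY NAME from the three named stubs.
The engine: split `span_ℚ(z) = (span z ∩ E₂) ⊕ U`, take bases, clear denominators, count the
`E₂`-part over `L` (stubs 1+2), the complement over `L₂ ⊇ L(y, e^y)` (stub 3) pushed down by base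
change (`trdeg_adjoin_le_of_le`), add along the tower (`add_le_trdeg_adjoin_union`) and include
into `L(z, e^z)` (`mem_adjoin_of_mem_span_int`, `trdeg_le_of_injective`). The abstract engine is
`relSectorEngine`.

Placeholders: exactly three, one inside each `stub_*`; none elsewhere.
-/

namespace Summit.Schanuel.Schanuel.Cruxes.RelOverRealCore.Birth

open Literature.NumberTheory.Transcendental

/-- STUB (BC5 rung, n = 1 of the rotation count; route header `RotationOne`): for a non-zero real
Khovanskii point `b ∈ P = ecl^ℝ(∅)` the rotation value `exp (i b)` is transcendental over
`L = ℚ(Pc)`. Why plausible: it is the `n = 1`, rotation-sector instance of Schanuel relative to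
the real core (SC gives it); why it might fail: `b = 1` asks `e^i` transcendental over the
infinite-trdeg field `ℚ(P) ∋ e, e^e, …` — open; complex conjugation fixes `L` pointwise and
inverts `exp (i b)` (Diaz 2009, Thm 1 is the base-`ℚ̄` prototype). Size: L. -/
theorem stub_rotationOne :
    ∀ b : ℝ, b ∈ Literature.NumberTheory.Transcendental.ecl (∅ : Set ℝ) → b ≠ 0 →
      Transcendental ↥(IntermediateField.adjoin ℚ (Complex.ofReal '' Literature.NumberTheory.Transcendental.ecl (∅ : Set ℝ))) (Complex.exp ((b : ℂ) * Complex.I)) := by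
  sorry

/-- STUB (route header `RotationCountGe2`): the relative Schanuel count over `L = ℚ(Pc)` for tuples
of length `k ≥ 2` lying in the rotation sector `E₂ = span_ℚ(Pc ∪ i·Pc)` and `ℚ`-free modulo
`E = span_ℚ Pc`. Why plausible: a consequence of SC (tuples `(a_j + i b_j)` with `b` `ℚ`-free in
`P`); why it might fail: already at `k = 2` it contains algebraic independence of two rotation
values `exp (i b₁), exp (i b₂)` over `ℚ(P)`. Size: XL. -/
theorem stub_rotationCountGe2 :
    ∀ (k : ℕ) (y : Fin k → ℂ), 2 ≤ k →
      (∀ i, y i ∈ Submodule.span ℚ ((Complex.ofReal '' Literature.NumberTheory.Transcendental.ecl (∅ : Set ℝ)) ∪ ((fun b : ℝ => (b : ℂ) * Complex.I) '' Literature.NumberTheory.Transcendental.ecl (∅ : Set ℝ)))) →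
      LinearIndependent ℚ ((Submodule.span ℚ (Complex.ofReal '' Literature.NumberTheory.Transcendental.ecl (∅ : Set ℝ))).mkQ ∘ y) →
      (k : Cardinal) ≤ Algebra.trdeg ↥(IntermediateField.adjoin ℚ (Complex.ofReal '' Literature.NumberTheory.Transcendental.ecl (∅ : Set ℝ)))
        ↥(IntermediateField.adjoin ↥(IntermediateField.adjoin ℚ (Complex.ofReal '' Literature.NumberTheory.Transcendental.ecl (∅ : Set ℝ))) (Set.range y ∪ Set.range (Complex.exp ∘ y))) := by
  sorry

/-- STUB (route header `OffCoreCount`): the relative Schanuel count over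
`L₂ = L(E₂, exp E₂)` (`L = ℚ(Pc)`, `E₂ = span_ℚ(Pc ∪ i·Pc)`) for complex tuples `ℚ`-free modulo
the rotation sector `E₂`. Why plausible: the off-sector factor of SC in Kirby's `GL_n(ℚ)`
bookkeeping (Kirby 2010 §7), the analogue of Thm 1.2 with the complex core replaced by the
rotation sector; why it might fail: `u = (iπ)` is free mod `E₂` (if `π ∉ P`) and the instance says
`π` is transcendental over `ℚ(P, iP, exp (iP))` — no derivation argument reaches below the
`∂`-constants. Size: XL. -/
theorem stub_offCoreCount :
    ∀ (m : ℕ) (u : Fin m → ℂ),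
      LinearIndependent ℚ ((Submodule.span ℚ ((Complex.ofReal '' Literature.NumberTheory.Transcendental.ecl (∅ : Set ℝ)) ∪ ((fun b : ℝ => (b : ℂ) * Complex.I) '' Literature.NumberTheory.Transcendental.ecl (∅ : Set ℝ)))).mkQ ∘ u) →
      (m : Cardinal) ≤ Algebra.trdeg ↥(IntermediateField.adjoin ↥(IntermediateField.adjoin ℚ (Complex.ofReal '' Literature.NumberTheory.Transcendental.ecl (∅ : Set ℝ))) ((Submodule.span ℚ ((Complex.ofReal '' Literature.NumberTheory.Transcendental.ecl (∅ : Set ℝ)) ∪ ((fun b : ℝ => (b : ℂ) * Complex.I) '' Literature.NumberTheory.Transcendental.ecl (∅ : Set ℝ))) : Set ℂ) ∪ Complex.exp '' (Submodule.span ℚ ((Complex.ofReal '' Literature.NumberTheory.Transcendental.ecl (∅ : Set ℝ)) ∪ ((fun b : ℝ => (b : ℂ) * Complex.I) '' Literature.NumberTheory.Transcendental.ecl (∅ : Set ℝ))) : Set ℂ)))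
        ↥(IntermediateField.adjoin ↥(IntermediateField.adjoin ↥(IntermediateField.adjoin ℚ (Complex.ofReal '' Literature.NumberTheory.Transcendental.ecl (∅ : Set ℝ))) ((Submodule.span ℚ ((Complex.ofReal '' Literature.NumberTheory.Transcendental.ecl (∅ : Set ℝ)) ∪ ((fun b : ℝ => (b : ℂ) * Complex.I) '' Literature.NumberTheory.Transcendental.ecl (∅ : Set ℝ))) : Set ℂ) ∪ Complex.exp '' (Submodule.span ℚ ((Complex.ofReal '' Literature.NumberTheory.Transcendental.ecl (∅ : Set ℝ)) ∪ ((fun b : ℝ => (b : ℂ) * Complex.I) '' Literature.NumberTheory.Transcendental.ecl (∅ : Set ℝ))) : Set ℂ))) (Set.range u ∪ Set.range (Complex.exp ∘ u))) := by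
  sorry

/-! ### The relative sector engine (proved) -/

/-- **Relative sector engine** (shape of the route's `closes` and of Literature
`schanuelConjecture_iff_ecl_empty_of_kirby`, run over an intermediate base field `L`): if
`E ≤ E₂` are `ℚ`-subspaces of `ℂ`, `L₂ ⊇ L` contains `E₂` and `exp E₂`, tuples in `E₂` free
mod `E` are counted over `L` and tuples free mod `E₂` are counted over `L₂`, then every tuple free
mod `E` is counted over `L`. [folklore; Kirby 2010 §7 bookkeeping] -/
theorem relSectorEngine (E E₂ : Submodule ℚ ℂ) (hEE₂ : E ≤ E₂)
    (L : IntermediateField ℚ ℂ) (L₂ : IntermediateField L ℂ)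
    (hL₂ : ∀ w ∈ E₂, w ∈ L₂ ∧ Complex.exp w ∈ L₂)
    (hIn : ∀ (k : ℕ) (y : Fin k → ℂ), (∀ i, y i ∈ E₂) → LinearIndependent ℚ (E.mkQ ∘ y) →
      (k : Cardinal) ≤ Algebra.trdeg L
        (IntermediateField.adjoin L (Set.range y ∪ Set.range (Complex.exp ∘ y))))
    (hOut : ∀ (m : ℕ) (u : Fin m → ℂ), LinearIndependent ℚ (E₂.mkQ ∘ u) →
      (m : Cardinal) ≤ Algebra.trdeg L₂
        (IntermediateField.adjoin L₂ (Set.range u ∪ Set.range (Complex.exp ∘ u))))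
    (n : ℕ) (z : Fin n → ℂ) (hz : LinearIndependent ℚ (E.mkQ ∘ z)) :
    (n : Cardinal) ≤ Algebra.trdeg L
      (IntermediateField.adjoin L (Set.range z ∪ Set.range (Complex.exp ∘ z))) := by
  classical
  have _hEE₂ := hEE₂
  have hzli : LinearIndependent ℚ z := LinearIndependent.of_comp _ hz
  have hVE : Disjoint (Submodule.span ℚ (Set.range z)) E := by
    have h := Submodule.range_ker_disjoint hz
    rwa [Submodule.ker_mkQ] at h
  set V : Submodule ℚ ℂ := Submodule.span ℚ (Set.range z) with hV
  haveI : FiniteDimensional ℚ V := FiniteDimensional.span_of_finite ℚ (Set.finite_range z)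
  obtain ⟨U', hU'⟩ := (V ⊓ E₂).exists_isCompl
  set W : Submodule ℚ ℂ := V ⊓ E₂
  set U : Submodule ℚ ℂ := V ⊓ U' with hU
  haveI : FiniteDimensional ℚ W := Submodule.finiteDimensional_of_le inf_le_left
  haveI : FiniteDimensional ℚ U := Submodule.finiteDimensional_of_le inf_le_left
  have hsup : W ⊔ U = V := by
    rw [hU, inf_comm, ← sup_inf_assoc_of_le U' (inf_le_left : W ≤ V), hU'.sup_eq_top, top_inf_eq]
  have hdj : Disjoint W U := hU'.disjoint.mono_right inf_le_right
  have hUE₂ : Disjoint U E₂ := by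
    rw [Submodule.disjoint_def]
    intro a haU haE
    exact (Submodule.disjoint_def.mp hdj) a ⟨inf_le_left (b := U') haU, haE⟩ haU
  set k := Module.finrank ℚ W
  set m := Module.finrank ℚ U
  have hn : k + m = n := by
    have h1 := Submodule.finrank_sup_add_finrank_inf_eq W U
    rw [hdj.eq_bot, finrank_bot, add_zero, hsup, hV, finrank_span_eq_card hzli,
      Fintype.card_fin] at h1
    exact h1.symm
  let bW := Module.finBasis ℚ W
  let bU := Module.finBasis ℚ U
  let y : Fin k → ℂ := fun i => bW i
  let u : Fin m → ℂ := fun j => bU j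
  have hyli : LinearIndependent ℚ y := bW.linearIndependent.map' W.subtype W.ker_subtype
  have huli : LinearIndependent ℚ u := bU.linearIndependent.map' U.subtype U.ker_subtype
  have hyE₂ : ∀ i, y i ∈ E₂ := fun i => (bW i).2.2
  have hyV : ∀ i, y i ∈ V := fun i => (bW i).2.1
  have huU : ∀ j, u j ∈ U := fun j => (bU j).2
  have huV : ∀ j, u j ∈ V := fun j => inf_le_left (b := U') (huU j)
  -- clear denominators so that `y, u` (and their exponentials) lie in `L(z, e^z)`
  choose Ny hNy hNy_mem using fun i => exists_nsmul_mem_span_int z (hyV i)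
  choose Nu hNu hNu_mem using fun j => exists_nsmul_mem_span_int z (huV j)
  let cy : Fin k → ℚˣ := fun i => Units.mk0 (Ny i : ℚ) (Nat.cast_ne_zero.mpr (hNy i))
  let cu : Fin m → ℚˣ := fun j => Units.mk0 (Nu j : ℚ) (Nat.cast_ne_zero.mpr (hNu j))
  let y' : Fin k → ℂ := fun i => (Ny i : ℚ) • y i
  let u' : Fin m → ℂ := fun j => (Nu j : ℚ) • u j
  have hy'_eq : cy • y = y' := by
    funext i; simp only [Pi.smul_apply', cy, y', Units.smul_def, Units.val_mk0]
  have hu'_eq : cu • u = u' := by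
    funext j; simp only [Pi.smul_apply', cu, u', Units.smul_def, Units.val_mk0]
  have hy'li : LinearIndependent ℚ y' := hy'_eq ▸ hyli.units_smul cy
  have hu'li : LinearIndependent ℚ u' := hu'_eq ▸ huli.units_smul cu
  have hy'E₂ : ∀ i, y' i ∈ E₂ := fun i => E₂.smul_mem _ (hyE₂ i)
  have hy'V : ∀ i, y' i ∈ V := fun i => V.smul_mem _ (hyV i)
  have hu'U : ∀ j, u' j ∈ U := fun j => U.smul_mem _ (huU j)
  have hy'modE : LinearIndependent ℚ (E.mkQ ∘ y') := by
    refine hy'li.map ?_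
    rw [Submodule.ker_mkQ]
    exact hVE.mono_left (Submodule.span_le.mpr (Set.range_subset_iff.mpr hy'V))
  have hu'modE₂ : LinearIndependent ℚ (E₂.mkQ ∘ u') := by
    refine hu'li.map ?_
    rw [Submodule.ker_mkQ]
    exact hUE₂.mono_left (Submodule.span_le.mpr (Set.range_subset_iff.mpr hu'U))
  -- the two counts and the tower, over the base `L`
  set Sy : Set ℂ := Set.range y' ∪ Set.range (Complex.exp ∘ y') with hSy
  set Su : Set ℂ := Set.range u' ∪ Set.range (Complex.exp ∘ u') with hSu
  set Ky : IntermediateField L ℂ := IntermediateField.adjoin L Sy with hKy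
  have hk : (k : Cardinal) ≤ Algebra.trdeg L Ky := hIn k y' hy'E₂ hy'modE
  have hm₀ : (m : Cardinal) ≤ Algebra.trdeg L₂ (IntermediateField.adjoin L₂ Su) :=
    hOut m u' hu'modE₂
  have hKyL₂ : Ky ≤ L₂ := by
    rw [hKy, IntermediateField.adjoin_le_iff]
    rintro a (⟨i, rfl⟩ | ⟨i, rfl⟩)
    · exact (hL₂ _ (hy'E₂ i)).1
    · exact (hL₂ _ (hy'E₂ i)).2
  have hm : (m : Cardinal) ≤ Algebra.trdeg Ky (IntermediateField.adjoin Ky Su) :=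
    hm₀.trans (trdeg_adjoin_le_of_le hKyL₂ Su)
  have hkm : (k : Cardinal) + (m : Cardinal) ≤
      Algebra.trdeg L (IntermediateField.adjoin L (Sy ∪ Su)) :=
    add_le_trdeg_adjoin_union Sy Su hk hm
  -- comparison with `L(z, e^z)`
  set Kz : IntermediateField L ℂ :=
    IntermediateField.adjoin L (Set.range z ∪ Set.range (Complex.exp ∘ z)) with hKz
  have hQL : IntermediateField.adjoin ℚ (Set.range z ∪ Set.range (Complex.exp ∘ z)) ≤
      Kz.restrictScalars ℚ :=
    IntermediateField.adjoin_le_iff.mpr (IntermediateField.subset_adjoin L _)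
  have hle : IntermediateField.adjoin L (Sy ∪ Su) ≤ Kz := by
    rw [IntermediateField.adjoin_le_iff]
    rintro a ((⟨i, rfl⟩ | ⟨i, rfl⟩) | (⟨j, rfl⟩ | ⟨j, rfl⟩))
    · exact hQL (mem_adjoin_of_mem_span_int z (hNy_mem i)).1
    · exact hQL (mem_adjoin_of_mem_span_int z (hNy_mem i)).2
    · exact hQL (mem_adjoin_of_mem_span_int z (hNu_mem j)).1
    · exact hQL (mem_adjoin_of_mem_span_int z (hNu_mem j)).2
  have hfin : Algebra.trdeg L (IntermediateField.adjoin L (Sy ∪ Su)) ≤ Algebra.trdeg L Kz :=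
    trdeg_le_of_injective (IntermediateField.inclusion hle)
      (IntermediateField.inclusion_injective hle)
  calc (n : Cardinal) = (k : Cardinal) + (m : Cardinal) := by rw [← hn, Nat.cast_add]
    _ ≤ Algebra.trdeg L (IntermediateField.adjoin L (Sy ∪ Su)) := hkm
    _ ≤ Algebra.trdeg L Kz := hfin

/-! ### The `k = 1` rotation count from `stub_rotationOne` (proved glue) -/

/-- **Rotation count at `k = 1`** (route header: `rotationCount_of_one`): a single element of the
rotation sector `E₂` that is non-zero modulo `E = span_ℚ Pc` is `a + i b` with `a, b ∈ P`,
`b ≠ 0`; since `e^a ∈ Pc ⊆ L`, the field `L(y, e^y)` contains the rotation value `exp (i b)`,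
transcendental over `L` by `stub_rotationOne`, so the relative count is `≥ 1`. [folklore] -/
theorem rotationCount_one
    (hOne : ∀ b : ℝ, b ∈ Literature.NumberTheory.Transcendental.ecl (∅ : Set ℝ) → b ≠ 0 →
      Transcendental ↥(IntermediateField.adjoin ℚ (Complex.ofReal '' Literature.NumberTheory.Transcendental.ecl (∅ : Set ℝ))) (Complex.exp ((b : ℂ) * Complex.I)))
    (y : Fin 1 → ℂ)
    (hy : y 0 ∈ Submodule.span ℚ ((Complex.ofReal '' Literature.NumberTheory.Transcendental.ecl (∅ : Set ℝ)) ∪ ((fun b : ℝ => (b : ℂ) * Complex.I) '' Literature.NumberTheory.Transcendental.ecl (∅ : Set ℝ))))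
    (hli : LinearIndependent ℚ ((Submodule.span ℚ (Complex.ofReal '' Literature.NumberTheory.Transcendental.ecl (∅ : Set ℝ))).mkQ ∘ y)) :
    ((1 : ℕ) : Cardinal) ≤ Algebra.trdeg ↥(IntermediateField.adjoin ℚ (Complex.ofReal '' Literature.NumberTheory.Transcendental.ecl (∅ : Set ℝ)))
      ↥(IntermediateField.adjoin ↥(IntermediateField.adjoin ℚ (Complex.ofReal '' Literature.NumberTheory.Transcendental.ecl (∅ : Set ℝ))) (Set.range y ∪ Set.range (Complex.exp ∘ y))) := by
  classical
  set P : Set ℝ := Literature.NumberTheory.Transcendental.ecl (∅ : Set ℝ) with hP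
  set L : IntermediateField ℚ ℂ := IntermediateField.adjoin ℚ (Complex.ofReal '' P) with hL
  set K : IntermediateField L ℂ :=
    IntermediateField.adjoin L (Set.range y ∪ Set.range (Complex.exp ∘ y)) with hK
  -- `P` is an exp-closed subfield of `ℝ` (Kirby 2010, Lemma 3.3)
  have hP0 : (0 : ℝ) ∈ P := (Khovanskii.eclSubfield (∅ : Set ℝ)).zero_mem
  have hPadd : ∀ a ∈ P, ∀ b ∈ P, a + b ∈ P := fun a ha b hb =>
    (Khovanskii.eclSubfield (∅ : Set ℝ)).add_mem ha hb
  have hPrat : ∀ (q : ℚ), ∀ a ∈ P, (q : ℝ) * a ∈ P := fun q a ha =>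
    (Khovanskii.eclSubfield (∅ : Set ℝ)).mul_mem (SubfieldClass.ratCast_mem _ q) ha
  have hPexp : ∀ a ∈ P, Real.exp a ∈ P := fun a ha => Khovanskii.exp_mem_ecl ha
  -- elements of the rotation sector are `a + i b`, `a, b ∈ P`
  have hE₂ : ∀ w ∈ Submodule.span ℚ ((Complex.ofReal '' P) ∪
      ((fun b : ℝ => (b : ℂ) * Complex.I) '' P)),
      ∃ a ∈ P, ∃ b ∈ P, w = (a : ℂ) + (b : ℂ) * Complex.I := by
    intro w hw
    induction hw using Submodule.span_induction with
    | mem w hw =>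
      rcases hw with ⟨a, ha, rfl⟩ | ⟨b, hb, rfl⟩
      · exact ⟨a, ha, 0, hP0, by simp⟩
      · exact ⟨0, hP0, b, hb, by simp⟩
    | zero => exact ⟨0, hP0, 0, hP0, by simp⟩
    | add u v _ _ hu hv =>
      obtain ⟨a₁, ha₁, b₁, hb₁, rfl⟩ := hu
      obtain ⟨a₂, ha₂, b₂, hb₂, rfl⟩ := hv
      exact ⟨a₁ + a₂, hPadd _ ha₁ _ ha₂, b₁ + b₂, hPadd _ hb₁ _ hb₂, by push_cast; ring⟩
    | smul q u _ hu =>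
      obtain ⟨a, ha, b, hb, rfl⟩ := hu
      refine ⟨(q : ℝ) * a, hPrat q a ha, (q : ℝ) * b, hPrat q b hb, ?_⟩
      rw [Rat.smul_def]
      push_cast
      ring
  obtain ⟨a, ha, b, hb, hy0⟩ := hE₂ _ hy
  -- `b ≠ 0`, since `y 0` is non-zero modulo `E = span_ℚ Pc`
  have hb0 : b ≠ 0 := by
    rintro rfl
    refine hli.ne_zero 0 ?_
    simp only [Function.comp_apply, Submodule.mkQ_apply, Submodule.Quotient.mk_eq_zero, hy0,
      Complex.ofReal_zero, zero_mul, add_zero]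
    exact Submodule.subset_span ⟨a, ha, rfl⟩
  have hw : Transcendental L (Complex.exp ((b : ℂ) * Complex.I)) := hOne b hb hb0
  -- the rotation value `exp (i b) = exp (y 0) / e^a` lies in `K = L(y, e^y)`
  have hexpaL : Complex.exp (a : ℂ) ∈ L := by
    rw [← Complex.ofReal_exp]
    exact IntermediateField.subset_adjoin ℚ _ ⟨Real.exp a, hPexp a ha, rfl⟩
  have hexpaK : Complex.exp (a : ℂ) ∈ K := by
    have h := K.algebraMap_mem ⟨Complex.exp (a : ℂ), hexpaL⟩
    simpa using h
  have hexpy : Complex.exp (y 0) ∈ K :=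
    IntermediateField.subset_adjoin L _ (Or.inr ⟨0, rfl⟩)
  have hwK : Complex.exp ((b : ℂ) * Complex.I) ∈ K := by
    have h1 : Complex.exp ((b : ℂ) * Complex.I) =
        Complex.exp (y 0) * (Complex.exp (a : ℂ))⁻¹ := by
      rw [hy0, Complex.exp_add, mul_comm (Complex.exp (a : ℂ)), mul_assoc,
        mul_inv_cancel₀ (Complex.exp_ne_zero _), mul_one]
    rw [h1]
    exact mul_mem hexpy (inv_mem hexpaK)
  have hwK_tr : Transcendental L (⟨_, hwK⟩ : K) := fun halg =>
    hw (IntermediateField.isAlgebraic_iff.mp halg)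
  have hAI : AlgebraicIndependent L ![(⟨_, hwK⟩ : K)] :=
    algebraicIndependent_iff_transcendental.mpr hwK_tr
  have h := hAI.cardinalMk_le_trdeg
  simpa using h

/-! ### The composition: the three stub STATEMENTS imply the crux (proved, placeholder-free) -/

/-- **BC3 composition, implication form (proved outright).** The three stub statements imply the
body of `RelOverRealCore` verbatim: the relative sector engine at
`E = span_ℚ Pc ≤ E₂ = span_ℚ(Pc ∪ i·Pc)`, `L = ℚ(Pc)`, `L₂ = L(E₂, exp E₂)`, with the inside count
assembled from the `k = 1` rotation rung (`rotationCount_one`) and the `k ≥ 2` stub. Its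
conclusion is the crux's definiens, so `RelOverRealCore_of` below is this term applied to the
three named stubs. [folklore; Kirby 2010 §7 bookkeeping] -/
theorem relOverRealCore_of_counts :
    (∀ b : ℝ, b ∈ Literature.NumberTheory.Transcendental.ecl (∅ : Set ℝ) → b ≠ 0 →
      Transcendental ↥(IntermediateField.adjoin ℚ (Complex.ofReal '' Literature.NumberTheory.Transcendental.ecl (∅ : Set ℝ))) (Complex.exp ((b : ℂ) * Complex.I))) →
    (∀ (k : ℕ) (y : Fin k → ℂ), 2 ≤ k →
      (∀ i, y i ∈ Submodule.span ℚ ((Complex.ofReal '' Literature.NumberTheory.Transcendental.ecl (∅ : Set ℝ)) ∪ ((fun b : ℝ => (b : ℂ) * Complex.I) '' Literature.NumberTheory.Transcendental.ecl (∅ : Set ℝ)))) →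
      LinearIndependent ℚ ((Submodule.span ℚ (Complex.ofReal '' Literature.NumberTheory.Transcendental.ecl (∅ : Set ℝ))).mkQ ∘ y) →
      (k : Cardinal) ≤ Algebra.trdeg ↥(IntermediateField.adjoin ℚ (Complex.ofReal '' Literature.NumberTheory.Transcendental.ecl (∅ : Set ℝ)))
        ↥(IntermediateField.adjoin ↥(IntermediateField.adjoin ℚ (Complex.ofReal '' Literature.NumberTheory.Transcendental.ecl (∅ : Set ℝ))) (Set.range y ∪ Set.range (Complex.exp ∘ y)))) →
    (∀ (m : ℕ) (u : Fin m → ℂ),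
      LinearIndependent ℚ ((Submodule.span ℚ ((Complex.ofReal '' Literature.NumberTheory.Transcendental.ecl (∅ : Set ℝ)) ∪ ((fun b : ℝ => (b : ℂ) * Complex.I) '' Literature.NumberTheory.Transcendental.ecl (∅ : Set ℝ)))).mkQ ∘ u) →
      (m : Cardinal) ≤ Algebra.trdeg ↥(IntermediateField.adjoin ↥(IntermediateField.adjoin ℚ (Complex.ofReal '' Literature.NumberTheory.Transcendental.ecl (∅ : Set ℝ))) ((Submodule.span ℚ ((Complex.ofReal '' Literature.NumberTheory.Transcendental.ecl (∅ : Set ℝ)) ∪ ((fun b : ℝ => (b : ℂ) * Complex.I) '' Literature.NumberTheory.Transcendental.ecl (∅ : Set ℝ))) : Set ℂ) ∪ Complex.exp '' (Submodule.span ℚ ((Complex.ofReal '' Literature.NumberTheory.Transcendental.ecl (∅ : Set ℝ)) ∪ ((fun b : ℝ => (b : ℂ) * Complex.I) '' Literature.NumberTheory.Transcendental.ecl (∅ : Set ℝ))) : Set ℂ)))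
        ↥(IntermediateField.adjoin ↥(IntermediateField.adjoin ↥(IntermediateField.adjoin ℚ (Complex.ofReal '' Literature.NumberTheory.Transcendental.ecl (∅ : Set ℝ))) ((Submodule.span ℚ ((Complex.ofReal '' Literature.NumberTheory.Transcendental.ecl (∅ : Set ℝ)) ∪ ((fun b : ℝ => (b : ℂ) * Complex.I) '' Literature.NumberTheory.Transcendental.ecl (∅ : Set ℝ))) : Set ℂ) ∪ Complex.exp '' (Submodule.span ℚ ((Complex.ofReal '' Literature.NumberTheory.Transcendental.ecl (∅ : Set ℝ)) ∪ ((fun b : ℝ => (b : ℂ) * Complex.I) '' Literature.NumberTheory.Transcendental.ecl (∅ : Set ℝ))) : Set ℂ))) (Set.range u ∪ Set.range (Complex.exp ∘ u)))) →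
    ∀ (n : ℕ) (z : Fin n → ℂ), LinearIndependent ℚ ((Submodule.span ℚ (Complex.ofReal '' Literature.NumberTheory.Transcendental.ecl (∅ : Set ℝ))).mkQ ∘ z) →
      (n : Cardinal) ≤ Algebra.trdeg ↥(IntermediateField.adjoin ℚ (Complex.ofReal '' Literature.NumberTheory.Transcendental.ecl (∅ : Set ℝ)))
        ↥(IntermediateField.adjoin ↥(IntermediateField.adjoin ℚ (Complex.ofReal '' Literature.NumberTheory.Transcendental.ecl (∅ : Set ℝ))) (Set.range z ∪ Set.range (Complex.exp ∘ z))) := by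
  intro hOne hGe2 hOff n z hz
  refine relSectorEngine (Submodule.span ℚ (Complex.ofReal '' Literature.NumberTheory.Transcendental.ecl (∅ : Set ℝ))) (Submodule.span ℚ ((Complex.ofReal '' Literature.NumberTheory.Transcendental.ecl (∅ : Set ℝ)) ∪ ((fun b : ℝ => (b : ℂ) * Complex.I) '' Literature.NumberTheory.Transcendental.ecl (∅ : Set ℝ))))
    (Submodule.span_mono Set.subset_union_left) (IntermediateField.adjoin ℚ (Complex.ofReal '' Literature.NumberTheory.Transcendental.ecl (∅ : Set ℝ)))
    (IntermediateField.adjoin ↥(IntermediateField.adjoin ℚ (Complex.ofReal '' Literature.NumberTheory.Transcendental.ecl (∅ : Set ℝ))) ((Submodule.span ℚ ((Complex.ofReal '' Literature.NumberTheory.Transcendental.ecl (∅ : Set ℝ)) ∪ ((fun b : ℝ => (b : ℂ) * Complex.I) '' Literature.NumberTheory.Transcendental.ecl (∅ : Set ℝ))) : Set ℂ) ∪ Complex.exp '' (Submodule.span ℚ ((Complex.ofReal '' Literature.NumberTheory.Transcendental.ecl (∅ : Set ℝ)) ∪ ((fun b : ℝ => (b : ℂ) * Complex.I) '' Literature.NumberTheory.Transcendental.ecl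 (∅ : Set ℝ))) : Set ℂ)))
    ?_ ?_ hOff n z hz
  · intro w hw
    exact ⟨IntermediateField.subset_adjoin _ _ (Or.inl hw),
      IntermediateField.subset_adjoin _ _ (Or.inr ⟨w, hw, rfl⟩)⟩
  · intro k
    match k with
    | 0 => intro y _ _; simp
    | 1 => intro y hyE₂ hymod; exact rotationCount_one hOne y (hyE₂ 0) hymod
    | (k + 2) => intro y hyE₂ hymod; exact hGe2 (k + 2) y (by omega) hyE₂ hymod

/-! ### The skeleton theorem: the crux BY NAME from the three named stubs -/

/-- **Skeleton theorem (A12 / BC3).** `RelOverRealCore` — concluded BY NAME — from the three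
declared stubs `stub_rotationOne`, `stub_rotationCountGe2`, `stub_offCoreCount` through the proved
implication `relOverRealCore_of_counts`; the only placeholders in its closure are the three stubs.
[folklore; Kirby 2010 §7 bookkeeping] -/
theorem RelOverRealCore_of :
    Summit.Schanuel.Schanuel.Theses.RealCoreRotationSplit.RelOverRealCore :=
  relOverRealCore_of_counts stub_rotationOne stub_rotationCountGe2 stub_offCoreCount

end Summit.Schanuel.Schanuel.Cruxes.RelOverRealCore.Birth
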